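import Summits.BirchSwinnertonDyer.Rank1Residual.Additive.PadicBallSeriesEval
import Literature.NumberTheory.EllipticCurves.FormalGroupChart
import Literature.NumberTheory.EllipticCurves.FormalGroupXDerivativeProofs
import Literature.NumberTheory.EllipticCurves.FormalGroupNegOmegaProofs
import Literature.NumberTheory.EllipticCurves.FormalGroupNegProofs
import Literature.NumberTheory.EllipticCurves.FormalGroupLaurentPoints
import HarnessLib

/-!
# The formal point with prescribed parameter over a complete ultrametric normed `ℚ_p`-algebra:
# `P(t) = (X(t)/t², −X(t)/t³) ∈ E₁(K)`, `z(P(t)) = t`, every `P ∈ E₁(K)` is `P(z(P))`, and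
# `−P(t) = P(i(t))` (cell `b2b-bsdres`, CLASS-CLOSURE lane, class O10 — x1b GEN 33, class lead;
# file 22 of the local series: the dictionary half of "the formal group law computes `E₁(K)`" for
# `K ⊇ ℚ_p` complete — Silverman AEC VII.2.2 beyond `K = ℚ_p`)

HONEST FRAMING (cell `b2b-bsdres`, run/shared/lean/b2b/bsd-rank1-residual/, verbatim in every
file): the goal of the cell is to DELETE the COMBINATION-SHAPED residual classes of the
Birch–Swinnerton-Dyer formula for ALL analytic-rank `≤ 1` elliptic curves over `ℚ` — "full BSD
formula for every rank `≤ 1` curve in class `C`" assembled STRICTLY from published theorems — so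
that the rank-`≤ 1` remainder becomes exactly the CONSTRUCTION-SHAPED classes, which are TYPED
(missing-input `Prop`s), NOT attempted. This is not "finishing BSD". CLASS-CLOSURE lane: prove
what is provable now; shrink each hard class to its core with data; no claim beyond stated classes;
research routes on CONSTRUCTION-SHAPED X12 / O10; census / instrument output = EVIDENCE / conjecture
items, NEVER a Literature fact; `RESIDUAL-MAP.md` marks change only by signed lines. THIS FILE:
TOOL DEFINITIONS + THEOREMS (definitions with bodies: `curveK`, `evX`, `ptOf`; every statement
proved) — no named Literature fact, no Summits-side fact `def … : Prop`, no `sorry`, axioms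
standard; nothing is booked; no label / mark / count / sub-cell moves; O10 stays OPEN /
CONSTRUCTION-SHAPED; nothing about `BSD(W, p)` of any pair is claimed.

## Setting and content

`M` is a Weierstrass equation over `ℤ_p` with elliptic generic fibre; `K` a complete ultrametric
normed `ℚ_p`-algebra which is a field (`𝒪 = unitBall K`); `E = curveK p K M = M ⊗ K`;
`w = NormedField.valuation` (so `w.integer = 𝒪` and `E₁(K) = FormalGroupChart.kernel w E`);
for `t ∈ 𝒪` with `‖t‖ < 1`, `X(t) = ev₁ t (formalXMulSq M)` (`X = z²x(z) = 1 − a₁z − …`,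
AEC IV.1).

* §1 `curveK`, its integrality (`isIntegral_curveK`, to be used with `haveI`) and ellipticity;
  `evX`, `‖X(t)‖ = 1`; the Weierstrass equation of `(X(t)/t², −X(t)/t³)` (`equation_chart`, the
  tree's formal identity `formalXMulSq_sq_eq` evaluated at `t`).
* §2 `ptOf p K M t ht ∈ E(K)` (`= O` for `t = 0`), `ptOf_mem_kernel`, `zCoord_ptOf = t`,
  **`eq_ptOf_zCoord`**: every `P ∈ E₁(K)` is the formal point of its parameter (the tree's
  injectivity of `z` on `E₁`, `FormalGroupChart.zCoord_injOn`).
* §3 `neg_ptOf`: `−P(t) = P(i(t))`, `i = formalNeg` (the tree's formal identities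
  `formalXMulSq_subst_formalNeg_mul_X_sq`, `formalXMulSq_mul_formalNeg_add` evaluated at `t`).

References: [SilvermanAEC2009] IV.1–IV.2, VII.2.1–VII.2.2; the Laurent-series analogue is the
tree's `FormalGroupLaurentPoints` (whose field algebra `neg_aux_x/y` is reused).
-/

noncomputable section

open scoped Classical Topology NNReal
open Filter PowerSeries

namespace Summit.BirchSwinnertonDyer.Rank1Residual.Additive

namespace BallEval

open Literature.NumberTheory.GaloisRepresentations.LubinTate (unitBall mem_unitBall_iff)
open Literature.NumberTheory.EllipticCurves Literature.NumberTheory.EllipticCurves.FormalGroupChart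
open WeierstrassCurve

variable (p : ℕ) [hp : Fact p.Prime] (K : Type*) [NontriviallyNormedField K] [NormedAlgebra ℚ_[p] K]
  [IsUltrametricDist K] [CompleteSpace K] (M : WeierstrassCurve ℤ_[p])

/-! ## §1 The curve over `K`, `X(t)`, and the equation in the chart -/

/-- **`E = M ⊗ K`**, the base change of `M/ℤ_p` along `ℤ_p → 𝒪_K ⊂ K`. [folklore] -/
def curveK : WeierstrassCurve K := M.map ((unitBall K).subtype.comp (coeffHom p K))

omit [CompleteSpace K] in
/-- The coefficients of `curveK`. [folklore] -/
theorem curveK_a : (curveK p K M).a₁ = (coeffHom p K M.a₁ : K) ∧ (curveK p K M).a₂ = (coeffHom p K M.a₂ : K) ∧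
    (curveK p K M).a₃ = (coeffHom p K M.a₃ : K) ∧ (curveK p K M).a₄ = (coeffHom p K M.a₄ : K) ∧
    (curveK p K M).a₆ = (coeffHom p K M.a₆ : K) :=
  ⟨rfl, rfl, rfl, rfl, rfl⟩

omit [CompleteSpace K] in
/-- `curveK` has `𝒪_K`-integral coefficients (a theorem; introduce with `haveI`). [folklore] -/
theorem isIntegral_curveK : (curveK p K M).IsIntegral (NormedField.valuation (K := K)).integer :=
  ⟨⟨M.map (coeffHom p K), by rw [curveK, WeierstrassCurve.baseChange, WeierstrassCurve.map_map]; rfl⟩⟩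

omit [CompleteSpace K] in
/-- `curveK` is an elliptic curve when the generic fibre of `M` is. [folklore] -/
theorem isElliptic_curveK [hE : (M.map PadicInt.Coe.ringHom).IsElliptic] : (curveK p K M).IsElliptic := by
  refine ⟨?_⟩
  have h : (curveK p K M).Δ = algebraMap ℚ_[p] K ((M.map PadicInt.Coe.ringHom).Δ) := by
    rw [curveK, WeierstrassCurve.map_Δ, WeierstrassCurve.map_Δ]; rfl
  rw [h, isUnit_iff_ne_zero, map_ne_zero_iff _ (algebraMap ℚ_[p] K).injective]
  exact (M.map PadicInt.Coe.ringHom).isUnit_Δ.ne_zero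

variable {K}

/-- **`X(t) = ev₁ t (z²x(z))`**, the value of `formalXMulSq` at a point of the open disc.
[cite: SilvermanAEC2009, IV.1] -/
def evX (t : unitBall K) (ht : ‖(t : K)‖ < 1) : K :=
  ((ev₁ p K t (hasEval_of_norm_lt_one ht) M.formalXMulSq : unitBall K) : K)

variable {p M}

/-- `‖X(t) − 1‖ ≤ ‖t‖ < 1` (`X = 1 + (terms divisible by z)`). [folklore] -/
theorem norm_evX_sub_one_le {t : unitBall K} (ht : ‖(t : K)‖ < 1) : ‖evX p M t ht - 1‖ ≤ ‖(t : K)‖ := by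
  have ht1 : ‖(t : K)‖ ≤ 1 := ht.le
  have h0 : PowerSeries.constantCoeff (M.formalXMulSq - 1) = 0 := by
    rw [map_sub, M.constantCoeff_formalXMulSq, map_one, sub_self]
  have := norm_ev₁_le (hasEval_of_norm_lt_one ht) ht1 h0
  rwa [map_sub, map_one, AddSubgroupClass.coe_sub, OneMemClass.coe_one] at this

/-- **`‖X(t)‖ = 1`.** [folklore] -/
theorem norm_evX {t : unitBall K} (ht : ‖(t : K)‖ < 1) : ‖evX p M t ht‖ = 1 := by
  have h := (norm_evX_sub_one_le (p := p) (M := M) ht).trans_lt ht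
  have e : evX p M t ht = 1 + (evX p M t ht - 1) := by ring
  rw [e, IsUltrametricDist.norm_add_eq_max_of_norm_ne_norm, norm_one, max_eq_left h.le]
  rw [norm_one]; exact (ne_of_lt h).symm

/-- `X(t) ≠ 0`. [folklore] -/
theorem evX_ne_zero {t : unitBall K} (ht : ‖(t : K)‖ < 1) : evX p M t ht ≠ 0 := by
  rw [← norm_ne_zero_iff, norm_evX (p := p) (M := M) ht]; exact one_ne_zero

/-- **The Weierstrass equation in the chart at a point**: with `A = X(t)`, `s = t`,
`A² = A³ + a₁sA² + a₂s²A² + a₃s³A + a₄s⁴A + a₆s⁶` (the tree's `formalXMulSq_sq_eq` evaluated).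
[cite: SilvermanAEC2009, IV.1] -/
theorem equation_chart {t : unitBall K} (ht : ‖(t : K)‖ < 1) :
    evX p M t ht ^ 2 = evX p M t ht ^ 3 + (coeffHom p K M.a₁ : K) * (t : K) * evX p M t ht ^ 2 +
      (coeffHom p K M.a₂ : K) * (t : K) ^ 2 * evX p M t ht ^ 2 +
      (coeffHom p K M.a₃ : K) * (t : K) ^ 3 * evX p M t ht +
      (coeffHom p K M.a₄ : K) * (t : K) ^ 4 * evX p M t ht + (coeffHom p K M.a₆ : K) * (t : K) ^ 6 := by
  have h := congrArg (fun f => ((ev₁ p K t (hasEval_of_norm_lt_one ht) f : unitBall K) : K))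
    M.formalXMulSq_sq_eq
  simp only [map_add, map_mul, map_pow, ev₁_X, ev₁_C, Subring.coe_add, Subring.coe_mul,
    SubmonoidClass.coe_pow] at h
  exact h

variable (p K M) in
/-- The affine coordinates of the formal point satisfy the Weierstrass equation of `E`.
[cite: SilvermanAEC2009, IV.1] -/
theorem equation_ptOf {t : unitBall K} (ht : ‖(t : K)‖ < 1) (ht0 : (t : K) ≠ 0) :
    (curveK p K M).toAffine.Equation (evX p M t ht / (t : K) ^ 2) (-evX p M t ht / (t : K) ^ 3) := by
  have hid := equation_chart (p := p) (M := M) ht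
  have hs6 : (t : K) ^ 6 ≠ 0 := pow_ne_zero 6 ht0
  rw [Affine.equation_iff]
  simp only [curveK, map_a₁, map_a₂, map_a₃, map_a₄, map_a₆, RingHom.coe_comp, Function.comp_apply,
    Subring.coe_subtype]
  set A : K := evX p M t ht
  set s : K := (t : K)
  have e1 : (-A / s ^ 3) ^ 2 + (coeffHom p K M.a₁ : K) * (A / s ^ 2) * (-A / s ^ 3) +
      (coeffHom p K M.a₃ : K) * (-A / s ^ 3) =
      (A ^ 2 - (coeffHom p K M.a₁ : K) * s * A ^ 2 - (coeffHom p K M.a₃ : K) * s ^ 3 * A) / s ^ 6 := by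
    field_simp
    ring
  have e2 : (A / s ^ 2) ^ 3 + (coeffHom p K M.a₂ : K) * (A / s ^ 2) ^ 2 +
      (coeffHom p K M.a₄ : K) * (A / s ^ 2) + (coeffHom p K M.a₆ : K) =
      (A ^ 3 + (coeffHom p K M.a₂ : K) * s ^ 2 * A ^ 2 + (coeffHom p K M.a₄ : K) * s ^ 4 * A +
        (coeffHom p K M.a₆ : K) * s ^ 6) / s ^ 6 := by
    field_simp
  rw [e1, e2, div_left_inj' hs6]
  linear_combination hid

variable [hE : (M.map PadicInt.Coe.ringHom).IsElliptic]

variable (p K M) in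
/-- The formal point is nonsingular. [folklore] -/
theorem nonsingular_ptOf {t : unitBall K} (ht : ‖(t : K)‖ < 1) (ht0 : (t : K) ≠ 0) :
    (curveK p K M).toAffine.Nonsingular (evX p M t ht / (t : K) ^ 2) (-evX p M t ht / (t : K) ^ 3) := by
  haveI := isElliptic_curveK p K M
  exact (Affine.equation_iff_nonsingular (W := curveK p K M)).mp (equation_ptOf p K M ht ht0)

/-! ## §2 The formal point `P(t)` and the dictionary -/

variable (p K M) in
/-- **The formal point `P(t) = (X(t)/t², −X(t)/t³) ∈ E(K)`** with parameter `t` (`P(0) = O`).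
[cite: SilvermanAEC2009, Prop. VII.2.2] -/
def ptOf (t : unitBall K) (ht : ‖(t : K)‖ < 1) : (curveK p K M).toAffine.Point :=
  if ht0 : (t : K) = 0 then 0 else .some _ _ (nonsingular_ptOf p K M ht ht0)

/-- `P(t) = O` when `t = 0`. [folklore] -/
theorem ptOf_of_eq_zero {t : unitBall K} (ht : ‖(t : K)‖ < 1) (ht0 : (t : K) = 0) : ptOf p K M t ht = 0 := by
  rw [ptOf, dif_pos ht0]

/-- `P(t) = (X(t)/t², −X(t)/t³)` when `t ≠ 0`. [folklore] -/
theorem ptOf_of_ne_zero {t : unitBall K} (ht : ‖(t : K)‖ < 1) (ht0 : (t : K) ≠ 0) :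
    ptOf p K M t ht = .some _ _ (nonsingular_ptOf p K M ht ht0) := by
  rw [ptOf, dif_neg ht0]

/-- `ptOf` depends only on the underlying element. [folklore] -/
theorem ptOf_congr {t t' : unitBall K} (h : (t : K) = t') (ht : ‖(t : K)‖ < 1) (ht' : ‖(t' : K)‖ < 1) :
    ptOf p K M t ht = ptOf p K M t' ht' := by
  obtain rfl : t = t' := Subtype.ext h
  rfl

variable [hint : (curveK p K M).IsIntegral (NormedField.valuation (K := K)).integer]

/-- **`P(t) ∈ E₁(K)`** (`‖x(P(t))‖ = ‖t‖⁻² > 1`). [cite: SilvermanAEC2009, Prop. VII.2.2] -/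
theorem ptOf_mem_kernel {t : unitBall K} (ht : ‖(t : K)‖ < 1) :
    ptOf p K M t ht ∈ kernel (NormedField.valuation (K := K)) (curveK p K M) := by
  by_cases ht0 : (t : K) = 0
  · rw [ptOf_of_eq_zero ht ht0]; exact (kernel (NormedField.valuation (K := K)) (curveK p K M)).zero_mem
  · rw [ptOf_of_ne_zero ht ht0]
    refine some_mem_kernel _ ?_
    rw [← NNReal.coe_lt_coe, NormedField.valuation_apply, coe_nnnorm, NNReal.coe_one, norm_div, norm_pow,
      norm_evX (p := p) (M := M) ht]
    have h0 : 0 < ‖(t : K)‖ := norm_pos_iff.mpr ht0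
    rw [lt_div_iff₀ (pow_pos h0 2), one_mul]
    nlinarith

omit hint in
/-- **`z(P(t)) = t`.** [cite: SilvermanAEC2009, Prop. VII.2.2] -/
theorem zCoord_ptOf {t : unitBall K} (ht : ‖(t : K)‖ < 1) : (ptOf p K M t ht).zCoord = (t : K) := by
  by_cases ht0 : (t : K) = 0
  · rw [ptOf_of_eq_zero ht ht0, ht0]; rfl
  · rw [ptOf_of_ne_zero ht ht0, Affine.Point.zCoord_some]
    have hX := evX_ne_zero (p := p) (M := M) ht
    field_simp

omit [CompleteSpace K] hE in
/-- `‖z(P)‖ < 1` on `E₁(K)`. [folklore] -/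
theorem norm_zCoord_lt_one {P : (curveK p K M).toAffine.Point}
    (hP : P ∈ kernel (NormedField.valuation (K := K)) (curveK p K M)) : ‖P.zCoord‖ < 1 := by
  have h := val_zCoord_lt_one hP
  rwa [← NNReal.coe_lt_coe, NormedField.valuation_apply, coe_nnnorm, NNReal.coe_one] at h

/-- The parameter of a point of `E₁(K)` as an element of `𝒪_K`. [folklore] -/
def zBall (P : (curveK p K M).toAffine.Point)
    (hP : P ∈ kernel (NormedField.valuation (K := K)) (curveK p K M)) : unitBall K :=
  ⟨P.zCoord, (mem_unitBall_iff K).mpr (norm_zCoord_lt_one hP).le⟩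

omit [CompleteSpace K] hE in
/-- `(zBall P : K) = z(P)`. [folklore] -/
@[simp] theorem coe_zBall {P : (curveK p K M).toAffine.Point}
    (hP : P ∈ kernel (NormedField.valuation (K := K)) (curveK p K M)) : (zBall P hP : K) = P.zCoord := rfl

omit [CompleteSpace K] hE in
/-- `‖zBall P‖ < 1`. [folklore] -/
theorem norm_zBall_lt_one {P : (curveK p K M).toAffine.Point}
    (hP : P ∈ kernel (NormedField.valuation (K := K)) (curveK p K M)) : ‖(zBall P hP : K)‖ < 1 :=
  norm_zCoord_lt_one hP

/-- **Every point of `E₁(K)` is the formal point of its parameter: `P = P(z(P))`** (injectivity of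
`z` on `E₁`, the tree's `zCoord_injOn`). [cite: SilvermanAEC2009, Prop. VII.2.2] -/
theorem eq_ptOf_zCoord {P : (curveK p K M).toAffine.Point}
    (hP : P ∈ kernel (NormedField.valuation (K := K)) (curveK p K M)) :
    P = ptOf p K M (zBall P hP) (norm_zBall_lt_one hP) :=
  zCoord_injOn hP (ptOf_mem_kernel _) (by rw [zCoord_ptOf]; rfl)

omit [CompleteSpace K] hE in
/-- Two points of `E₁(K)` with the same parameter are equal. [folklore] -/
theorem eq_of_zCoord_eq {P Q : (curveK p K M).toAffine.Point}
    (hP : P ∈ kernel (NormedField.valuation (K := K)) (curveK p K M))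
    (hQ : Q ∈ kernel (NormedField.valuation (K := K)) (curveK p K M)) (h : P.zCoord = Q.zCoord) : P = Q :=
  zCoord_injOn hP hQ h

/-! ## §3 Negation: `−P(t) = P(i(t))` -/

omit hE hint in
/-- `i(t) ∈ 𝒪_K` has norm `≤ ‖t‖ < 1`. [folklore] -/
theorem norm_ev₁_formalNeg_le {t : unitBall K} (ht : ‖(t : K)‖ < 1) :
    ‖((ev₁ p K t (hasEval_of_norm_lt_one ht) M.formalNeg : unitBall K) : K)‖ ≤ ‖(t : K)‖ :=
  norm_ev₁_le _ ht.le M.constantCoeff_formalNeg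

omit hE hint in
/-- `‖i(t)‖ < 1`. [folklore] -/
theorem norm_ev₁_formalNeg_lt_one {t : unitBall K} (ht : ‖(t : K)‖ < 1) :
    ‖((ev₁ p K t (hasEval_of_norm_lt_one ht) M.formalNeg : unitBall K) : K)‖ < 1 :=
  (norm_ev₁_formalNeg_le ht).trans_lt ht

omit hE hint in
/-- `X(i(t))` is `X` evaluated at `i(t)` (substitution compatibility). [folklore] -/
theorem ev₁_formalXMulSq_subst_formalNeg {t : unitBall K} (ht : ‖(t : K)‖ < 1) :
    ((ev₁ p K t (hasEval_of_norm_lt_one ht) (M.formalXMulSq.subst M.formalNeg) : unitBall K) : K) =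
      evX p M (ev₁ p K t (hasEval_of_norm_lt_one ht) M.formalNeg) (norm_ev₁_formalNeg_lt_one ht) := by
  rw [evX, ev₁_subst M.constantCoeff_formalNeg (hasEval_of_norm_lt_one ht)
    (hasEval_of_norm_lt_one (norm_ev₁_formalNeg_lt_one ht))]

omit hE hint in
/-- `i(t) ≠ 0` for `t ≠ 0` (`i(i(t)) = t`). [folklore] -/
theorem ev₁_formalNeg_ne_zero {t : unitBall K} (ht : ‖(t : K)‖ < 1) (ht0 : (t : K) ≠ 0) :
    ((ev₁ p K t (hasEval_of_norm_lt_one ht) M.formalNeg : unitBall K) : K) ≠ 0 := by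
  intro h
  have hii := congrArg (fun f => ((ev₁ p K t (hasEval_of_norm_lt_one ht) f : unitBall K) : K))
    M.formalNeg_subst_formalNeg_eq_X
  simp only [ev₁_X] at hii
  rw [ev₁_subst M.constantCoeff_formalNeg (hasEval_of_norm_lt_one ht)
    (hasEval_of_norm_lt_one (norm_ev₁_formalNeg_lt_one ht))] at hii
  have h0 : (ev₁ p K t (hasEval_of_norm_lt_one ht) M.formalNeg : unitBall K) = 0 := Subtype.ext h
  have : ((ev₁ p K (ev₁ p K t (hasEval_of_norm_lt_one ht) M.formalNeg)
      (hasEval_of_norm_lt_one (norm_ev₁_formalNeg_lt_one ht)) M.formalNeg : unitBall K) : K) = 0 := by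
    have hle := norm_ev₁_le (p := p) (K := K) (hasEval_of_norm_lt_one (norm_ev₁_formalNeg_lt_one (M := M) ht))
      (norm_ev₁_formalNeg_lt_one ht).le M.constantCoeff_formalNeg
    rw [h, norm_zero] at hle
    exact norm_le_zero_iff.mp hle
  rw [this] at hii
  exact ht0 hii.symm

omit hint in
/-- **`−P(t) = P(i(t))`** (`x(i(z)) = x(z)`, `y(i(z)) = −y − a₁x − a₃`: the tree's formal identities
`formalXMulSq_subst_formalNeg_mul_X_sq`, `formalXMulSq_mul_formalNeg_add` evaluated at `t`, then the
field algebra `neg_aux_x/y` of `FormalGroupLaurentPoints`). [cite: SilvermanAEC2009, IV.1] -/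
theorem neg_ptOf {t : unitBall K} (ht : ‖(t : K)‖ < 1) :
    -ptOf p K M t ht = ptOf p K M (ev₁ p K t (hasEval_of_norm_lt_one ht) M.formalNeg)
      (norm_ev₁_formalNeg_lt_one ht) := by
  by_cases ht0 : (t : K) = 0
  · have hi0 : ((ev₁ p K t (hasEval_of_norm_lt_one ht) M.formalNeg : unitBall K) : K) = 0 := by
      have hle := norm_ev₁_formalNeg_le (p := p) (M := M) ht
      rw [ht0, norm_zero] at hle
      exact norm_le_zero_iff.mp hle
    rw [ptOf_of_eq_zero ht ht0, neg_zero, ptOf_of_eq_zero _ hi0]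
  have hi0 := ev₁_formalNeg_ne_zero (p := p) (M := M) ht ht0
  rw [ptOf_of_ne_zero ht ht0, ptOf_of_ne_zero _ hi0, Affine.Point.neg_some, Affine.Point.some.injEq]
  have h1 := congrArg (fun f => ((ev₁ p K t (hasEval_of_norm_lt_one ht) f : unitBall K) : K))
    M.formalXMulSq_subst_formalNeg_mul_X_sq
  have h2 := congrArg (fun f => ((ev₁ p K t (hasEval_of_norm_lt_one ht) f : unitBall K) : K))
    M.formalXMulSq_mul_formalNeg_add
  simp only [map_mul, map_pow, map_add, map_sub, ev₁_X, ev₁_C, Subring.coe_mul, SubmonoidClass.coe_pow,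
    Subring.coe_add, AddSubgroupClass.coe_sub] at h1 h2
  rw [ev₁_formalXMulSq_subst_formalNeg ht] at h1
  simp only [Affine.negY, curveK, map_a₁, map_a₃, RingHom.coe_comp, Function.comp_apply, Subring.coe_subtype]
  refine ⟨neg_aux_x ht0 hi0 h1, ?_⟩
  change -(-evX p M t ht / (t : K) ^ 3) - (coeffHom p K M.a₁ : K) * (evX p M t ht / (t : K) ^ 2) -
      (coeffHom p K M.a₃ : K) = _
  exact neg_aux_y ht0 hi0 h1 h2

end BallEval

end Summit.BirchSwinnertonDyer.Rank1Residual.Additive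

end
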